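import Literature.AnabelianGeometry.SemiGraphs.GraphOfAnabelioids

/-!
# Regluing an object of `B(𝒢)` along its branches ([SemiAnbd] §2, Def. 2.1 pp. 22–23; Cor. 2.7 (i) p. 30)

Mochizuki, *Semi-graphs of anabelioids*, Publ. RIMS **42** (2006) 221–322, §2: an object of `B(𝒢)` is a
system `{S_v, T_e}` together with gluing isomorphisms `ψ_b : b^* S_v ⥲ T_e` along the branches
(Def. 2.1, pp. 22–23) [cite: MochizukiSemiAnbd2006, Def. 2.1 pp.22-23]; the proof of Cor. 2.7 (i) (p. 30)
manipulates such systems sheet by sheet ("`g · ℋ″`").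

abc-iut cell, layer L3, FACT-LIST row F-1487 (`covering_subgraphComponents_doubleCosets` AS TYPED),
seat abc-iut-w4-d080 — brick (R1) of the tree-free «regluing invisibility» route of
`HOME/staging/w4/w4-d080-g7/F1487-MASSBALANCE-MEMO.md` §5.  DEFINITIONS + bookkeeping only:

* `BObj.reglue B θ` — the object of `B(𝒢)` with the SAME vertex and edge objects as `B` and the gluing
  along every branch `b` post-composed with an automorphism `θ b` of the edge object `T_{e(b)}`
  (a branch-indexed family; regluing along a single branch is the family that is the identity elsewhere);
* `BObj.reglue_refl`, `BObj.reglue_reglue` — regluing by identities is `B`; regluings compose;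
* `BObj.Hom.reglue` — a morphism `g : B ⟶ A` whose edge components absorb the twists
  (`θ b ≫ g_e = g_e`, i.e. `θ` is an automorphism of `B` OVER `A` at every edge) is again a morphism
  `B.reglue θ ⟶ A` with the same components; `BObj.Hom.reglueIso` — regluing `B` by `θ` and `B′` by a
  family `θ′` intertwined by an isomorphism `B ≅ B′` gives isomorphic objects.

No fact is asserted; nothing here takes a side on [IUTchIII] Cor. 3.12.
-/

namespace Literature.AnabelianGeometry.SemiGraphs

open CategoryTheory

universe v₁ u₁ u

namespace SemiGraphOfAnabelioids

variable {𝒢 : SemiGraphOfAnabelioids.{v₁, u₁, u}}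

namespace BObj

/-- **Regluing.**  For an object `B = {S_v, T_e, ψ_b}` of `B(𝒢)` and a family of automorphisms
`θ_b ∈ Aut(T_{e(b)})` indexed by the branches of `𝔾`, the object `{S_v, T_e, ψ_b ≫ θ_b}`: same constituents,
gluing along `b` twisted by `θ_b` ([SemiAnbd] Def. 2.1: any family of isomorphisms `b^* S_v ⥲ T_e` is an
object). [cite: MochizukiSemiAnbd2006, Def. 2.1 pp.22-23] -/
def reglue (B : 𝒢.BObj) (θ : ∀ b : 𝒢.graph.Branch, B.T (𝒢.graph.edgeOf b) ≅ B.T (𝒢.graph.edgeOf b)) :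
    𝒢.BObj where
  S := B.S
  T := B.T
  ψ b v h := B.ψ b v h ≪≫ θ b

/-- Vertex objects are unchanged by regluing. [cite: MochizukiSemiAnbd2006, Def. 2.1 pp.22-23] -/
@[simp] theorem reglue_S (B : 𝒢.BObj)
    (θ : ∀ b : 𝒢.graph.Branch, B.T (𝒢.graph.edgeOf b) ≅ B.T (𝒢.graph.edgeOf b)) (v : 𝒢.graph.Vertex) :
    (B.reglue θ).S v = B.S v := rfl

/-- Edge objects are unchanged by regluing. [cite: MochizukiSemiAnbd2006, Def. 2.1 pp.22-23] -/
@[simp] theorem reglue_T (B : 𝒢.BObj)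
    (θ : ∀ b : 𝒢.graph.Branch, B.T (𝒢.graph.edgeOf b) ≅ B.T (𝒢.graph.edgeOf b)) (e : 𝒢.graph.Edge) :
    (B.reglue θ).T e = B.T e := rfl

/-- The gluing of the reglued object along `b` is `ψ_b ≫ θ_b`.
[cite: MochizukiSemiAnbd2006, Def. 2.1 pp.22-23] -/
@[simp] theorem reglue_ψ_hom (B : 𝒢.BObj)
    (θ : ∀ b : 𝒢.graph.Branch, B.T (𝒢.graph.edgeOf b) ≅ B.T (𝒢.graph.edgeOf b))
    (b : 𝒢.graph.Branch) (v : 𝒢.graph.Vertex) (h : 𝒢.graph.abuts b = some v) :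
    ((B.reglue θ).ψ b v h).hom = (B.ψ b v h).hom ≫ (θ b).hom := rfl

/-- The inverse gluing of the reglued object along `b` is `θ_b⁻¹ ≫ ψ_b⁻¹`.
[cite: MochizukiSemiAnbd2006, Def. 2.1 pp.22-23] -/
@[simp] theorem reglue_ψ_inv (B : 𝒢.BObj)
    (θ : ∀ b : 𝒢.graph.Branch, B.T (𝒢.graph.edgeOf b) ≅ B.T (𝒢.graph.edgeOf b))
    (b : 𝒢.graph.Branch) (v : 𝒢.graph.Vertex) (h : 𝒢.graph.abuts b = some v) :
    ((B.reglue θ).ψ b v h).inv = (θ b).inv ≫ (B.ψ b v h).inv := rfl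

/-- Regluing by the identity family gives back `B`. [cite: MochizukiSemiAnbd2006, Def. 2.1 pp.22-23] -/
theorem reglue_refl (B : 𝒢.BObj) : B.reglue (fun b => Iso.refl (B.T (𝒢.graph.edgeOf b))) = B := by
  cases B with
  | mk S T ψ =>
    simp only [reglue, Iso.trans_refl]

/-- Regluings compose: regluing by `θ` and then by `θ′` is regluing by `θ ≫ θ′`.
[cite: MochizukiSemiAnbd2006, Def. 2.1 pp.22-23] -/
theorem reglue_reglue (B : 𝒢.BObj)
    (θ θ' : ∀ b : 𝒢.graph.Branch, B.T (𝒢.graph.edgeOf b) ≅ B.T (𝒢.graph.edgeOf b)) :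
    (B.reglue θ).reglue θ' = B.reglue (fun b => θ b ≪≫ θ' b) := by
  cases B with
  | mk S T ψ =>
    simp only [reglue, Iso.trans_assoc]

/-- **A morphism over which the twists are invisible descends to the reglued object.**  If
`g : B ⟶ A` satisfies `θ_b ≫ g_{e(b)} = g_{e(b)}` for every branch `b` (each `θ_b` is an automorphism of
`T_{e(b)}` over `A_{e(b)}`), then the components of `g` form a morphism `B.reglue θ ⟶ A`.
[cite: MochizukiSemiAnbd2006, Def. 2.1 p.23] -/
def Hom.reglue {B A : 𝒢.BObj} (g : B ⟶ A)
    (θ : ∀ b : 𝒢.graph.Branch, B.T (𝒢.graph.edgeOf b) ≅ B.T (𝒢.graph.edgeOf b))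
    (hθ : ∀ b : 𝒢.graph.Branch, (θ b).hom ≫ g.fT (𝒢.graph.edgeOf b) = g.fT (𝒢.graph.edgeOf b)) :
    B.reglue θ ⟶ A where
  fS v := g.fS v
  fT e := g.fT e
  comm b v h := by
    show _ = (B.ψ b v h ≪≫ θ b).hom ≫ g.fT (𝒢.graph.edgeOf b)
    rw [Iso.trans_hom, Category.assoc, hθ b]
    exact g.comm b v h

/-- Vertex components of the descended morphism. [cite: MochizukiSemiAnbd2006, Def. 2.1 p.23] -/
@[simp] theorem Hom.reglue_fS {B A : 𝒢.BObj} (g : B ⟶ A)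
    (θ : ∀ b : 𝒢.graph.Branch, B.T (𝒢.graph.edgeOf b) ≅ B.T (𝒢.graph.edgeOf b))
    (hθ : ∀ b : 𝒢.graph.Branch, (θ b).hom ≫ g.fT (𝒢.graph.edgeOf b) = g.fT (𝒢.graph.edgeOf b))
    (v : 𝒢.graph.Vertex) : (Hom.reglue g θ hθ).fS v = g.fS v := rfl

/-- Edge components of the descended morphism. [cite: MochizukiSemiAnbd2006, Def. 2.1 p.23] -/
@[simp] theorem Hom.reglue_fT {B A : 𝒢.BObj} (g : B ⟶ A)
    (θ : ∀ b : 𝒢.graph.Branch, B.T (𝒢.graph.edgeOf b) ≅ B.T (𝒢.graph.edgeOf b))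
    (hθ : ∀ b : 𝒢.graph.Branch, (θ b).hom ≫ g.fT (𝒢.graph.edgeOf b) = g.fT (𝒢.graph.edgeOf b))
    (e : 𝒢.graph.Edge) : (Hom.reglue g θ hθ).fT e = g.fT e := rfl

/-- **Isomorphic data reglue to isomorphic objects.**  An isomorphism `i : B ≅ B′` intertwining two
families of twists (`θ_b ≫ i_{e(b)} = i_{e(b)} ≫ θ′_b`) induces an isomorphism `B.reglue θ ≅ B′.reglue θ′`
with the same components. [cite: MochizukiSemiAnbd2006, Def. 2.1 p.23] -/
def Hom.reglueIso {B B' : 𝒢.BObj} (i : B ≅ B')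
    (θ : ∀ b : 𝒢.graph.Branch, B.T (𝒢.graph.edgeOf b) ≅ B.T (𝒢.graph.edgeOf b))
    (θ' : ∀ b : 𝒢.graph.Branch, B'.T (𝒢.graph.edgeOf b) ≅ B'.T (𝒢.graph.edgeOf b))
    (hθ : ∀ b : 𝒢.graph.Branch,
      (θ b).hom ≫ i.hom.fT (𝒢.graph.edgeOf b) = i.hom.fT (𝒢.graph.edgeOf b) ≫ (θ' b).hom) :
    B.reglue θ ≅ B'.reglue θ' where
  hom :=
    { fS := fun v => i.hom.fS v
      fT := fun e => i.hom.fT e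
      comm := fun b v h => by
        show (𝒢.pull b v h).pullback.map (i.hom.fS v) ≫ (B'.ψ b v h ≪≫ θ' b).hom =
          (B.ψ b v h ≪≫ θ b).hom ≫ i.hom.fT (𝒢.graph.edgeOf b)
        rw [Iso.trans_hom, Iso.trans_hom, Category.assoc, hθ b, ← Category.assoc, i.hom.comm b v h,
          Category.assoc] }
  inv :=
    { fS := fun v => i.inv.fS v
      fT := fun e => i.inv.fT e
      comm := fun b v h => by
        have hθ' : (θ' b).hom ≫ i.inv.fT (𝒢.graph.edgeOf b) =
            i.inv.fT (𝒢.graph.edgeOf b) ≫ (θ b).hom := by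
          have h1 := congrArg (fun f => i.inv.fT (𝒢.graph.edgeOf b) ≫ f ≫ i.inv.fT (𝒢.graph.edgeOf b))
            (hθ b)
          simp only [Category.assoc] at h1
          have h2 : i.hom.fT (𝒢.graph.edgeOf b) ≫ i.inv.fT (𝒢.graph.edgeOf b) = 𝟙 _ := by
            rw [← BObj.comp_fT, i.hom_inv_id, BObj.id_fT]
          have h3 : i.inv.fT (𝒢.graph.edgeOf b) ≫ i.hom.fT (𝒢.graph.edgeOf b) = 𝟙 _ := by
            rw [← BObj.comp_fT, i.inv_hom_id, BObj.id_fT]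
          rw [h2, Category.comp_id, ← Category.assoc, h3, Category.id_comp] at h1
          exact h1.symm
        show (𝒢.pull b v h).pullback.map (i.inv.fS v) ≫ (B.ψ b v h ≪≫ θ b).hom =
          (B'.ψ b v h ≪≫ θ' b).hom ≫ i.inv.fT (𝒢.graph.edgeOf b)
        rw [Iso.trans_hom, Iso.trans_hom, Category.assoc, hθ', ← Category.assoc, i.inv.comm b v h,
          Category.assoc] }
  hom_inv_id := by
    apply BObj.hom_ext
    · funext x
      have h := congrArg (fun f : B ⟶ B => BObj.Hom.fS f x) i.hom_inv_id
      exact h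
    · funext x
      have h := congrArg (fun f : B ⟶ B => BObj.Hom.fT f x) i.hom_inv_id
      exact h
  inv_hom_id := by
    apply BObj.hom_ext
    · funext x
      have h := congrArg (fun f : B' ⟶ B' => BObj.Hom.fS f x) i.inv_hom_id
      exact h
    · funext x
      have h := congrArg (fun f : B' ⟶ B' => BObj.Hom.fT f x) i.inv_hom_id
      exact h

end BObj

end SemiGraphOfAnabelioids

end Literature.AnabelianGeometry.SemiGraphs
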